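import Mathlib
import Literature.AlgebraicGeometry.Resolution.CobordantGame
import Literature.AlgebraicGeometry.Resolution.CobordantChartCoefficients
import Literature.AlgebraicGeometry.Resolution.CobordantTupleGame
import Literature.AlgebraicGeometry.Resolution.FormalCoordinateChange
import Summits.ResolutionOfSingularities.ResolutionOfSingularities.Theorems.WeightedInvariantLocalWeightedDropMonicCurveBlowup
import Summits.ResolutionOfSingularities.ResolutionOfSingularities.Theorems.WeightedInvariantLocalWeightedDropWildTerminalApex
import Summits.ResolutionOfSingularities.ResolutionOfSingularities.Theorems.WeightedInvariantLocalWeightedDropWeierstrassForm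

/-!
# `WeightedInvariant.LocalWeightedDrop`, line `hasse-ridge-face-selection`: the SMALL-RESIDUAL terminal class of GENERAL
# monic surface forms `y^d + Σ_{j<d} A_j(x₁,x₂) y^j` is WON (piece S3ρT of the S3ρ line, first half)

Crux item stmt-ResolutionOfSingularities-8899 `LocalWeightedDrop` (route `ResolutionOfSingularities/WeightedInvariant`), engine of
the door `HypersurfaceCentreConstruction` stmt-ResolutionOfSingularities-19897.  [OURS · L1 W4.3, chain w43, res-type-083 (extra
seat S3ρ, CHAIN v4.3 D12): §1 (T) of `L/res-type-083/S3RHO-DESIGN.md`, the TermSR disjunct of `WildMonic.Terminal` in the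
evidence file `StubWildMonicDescent.lean` (line under the stub S3ρ `stub_wildMonicSurfaceReductionWon`).  Not a statement of any
manuscript; the mathematics is Perlega 2017/2020 §7.3 «small residual type» (arXiv:2011.14443) read on the coefficient tuple, as
a positional strategy of the local weighted resolution game — the tuple version of the small-residual branch of stub-1's S3πT
`stub_wildPurelyInseparableTerminalWon`.]

`termSR_won` (every characteristic, every `d ≥ 1`): given that the singular surface germs of order `< d` are won, a position
`y^d + Σ A_j y^j` (`ord A_j > d - j`) with `A_j = x_i^{(d-j)m} · g_j`, `m ≥ 1`, `g_j(0) = 0`, and `ord g_{j₁} < d - j₁` for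
some `j₁`, is won: blow up the curve `V(x_i, y)` (brick `won_monic_of_curveBlowup` with `A''_j = x_i^{(d-j)(m-1)} g_j`); the
successor tuple is `s^{(d-j)(m-1)} · g'_j` with `g'_j = c^{…} · (g_j ∘ chart_i)|`, `g'_j(0) = 0`, `ord g'_{j₁} < d - j₁`
(`WildTerminal.order_slice_subst_axisChart_lt`) — the same class with `m - 1` in the slot `0`, or, at `m = 1`, a germ of order
`< d`.
-/

set_option linter.dupNamespace false -- mandated namespace of this single-conjunct summit

namespace Summit.ResolutionOfSingularities.ResolutionOfSingularities.Theorems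

open Literature.AlgebraicGeometry.Resolution
open Literature.AlgebraicGeometry.Resolution.CobordantGame

namespace WildMonic

open MvPowerSeries WildTerminal

variable {k : Type} [Field k] {m : ℕ}

/-! ### Small tools on monic forms and orders -/

/-- A non-zero coefficient `[x'^β] A_j` bounds the order of the monic form by `|β| + j`. -/
theorem order_monicForm_le_of_coeff {d : ℕ} (A : Fin d → MvPowerSeries (Fin m) k) (j : Fin d) (β : Fin m →₀ ℕ)
    (h : coeff β (A j) ≠ 0) :
    (X (Fin.last m) ^ d + ∑ l : Fin d, rename (Fin.succAboveEmb (Fin.last m)) (A l) * X (Fin.last m) ^ (l : ℕ)).order ≤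
      ((β.degree + (j : ℕ) : ℕ) : ℕ∞) := by
  have hc : coeff (Finsupp.embDomain (Fin.succAboveEmb (Fin.last m)) β + Finsupp.single (Fin.last m) (j : ℕ))
      (X (Fin.last m) ^ d + ∑ l : Fin d, rename (Fin.succAboveEmb (Fin.last m)) (A l) * X (Fin.last m) ^ (l : ℕ)) ≠ 0 := by
    rw [WeierstrassForm.coeff_monicForm_of_lt]; exact h
  have := order_le hc
  rwa [TschirnhausForm.degree_emb_add_single] at this

/-- A series of order `< n` has a non-zero coefficient in degree `< n`. -/
theorem exists_coeff_ne_zero_of_order_lt {σ : Type} {g : MvPowerSeries σ k} {n : ℕ} (hg : g.order < (n : ℕ∞)) :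
    ∃ β : σ →₀ ℕ, β.degree < n ∧ coeff β g ≠ 0 := by
  by_contra hcon
  push Not at hcon
  have : (n : ℕ∞) ≤ g.order := nat_le_order fun β hβ => hcon β hβ
  exact absurd hg (not_lt.mpr this)

/-- Multiplying by a non-zero constant keeps an order bound. -/
theorem order_C_mul_lt {σ : Type} {a : k} (ha : a ≠ 0) {g : MvPowerSeries σ k} {n : ℕ} (hg : g.order < (n : ℕ∞)) :
    (C a * g).order < (n : ℕ∞) := by
  obtain ⟨β, hβ, hc⟩ := exists_coeff_ne_zero_of_order_lt hg
  refine lt_of_le_of_lt (order_le (d := β) ?_) (by exact_mod_cast hβ)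
  rw [coeff_C_mul]; exact mul_ne_zero ha hc

/-- `x_i^e · g` with `g(0) = 0` has order `≥ e + 1`. -/
theorem succ_le_order_X_pow_mul {σ : Type} (i : σ) (e : ℕ) {g : MvPowerSeries σ k} (hg : constantCoeff g = 0) :
    ((e + 1 : ℕ) : ℕ∞) ≤ ((X i : MvPowerSeries σ k) ^ e * g).order := by
  have h1 : (1 : ℕ∞) ≤ g.order := one_le_order_iff_constCoeff_eq_zero.mpr hg
  have hX : ((X i : MvPowerSeries σ k) ^ e).order = e := by
    classical
    rw [X_pow_eq, order_monomial, if_neg one_ne_zero, Finsupp.degree_single]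
  calc ((e + 1 : ℕ) : ℕ∞) = (e : ℕ∞) + 1 := Nat.cast_succ e
    _ ≤ ((X i : MvPowerSeries σ k) ^ e).order + g.order := by rw [hX]; exact add_le_add (le_refl _) h1
    _ ≤ _ := le_order_mul

/-! ### The curve-step successor of `x_i^{(d-j)(m-1)} · g` -/

/-- THE SUCCESSOR COEFFICIENT under the blow-up of `V(x_i, y)` at the exceptional point `c ≠ 0`:
`c^{d-j} · ((x_i^n g) ∘ chart_i)| = s^n · g'` with `g' = c^{d-j} c^n · (g ∘ chart_i)|` (recorded with its two properties:
`g'(0) = g(0)` up to the non-zero scalar, and an order bound `ord g < b ⇒ ord g' < b`). -/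
theorem curveSucc_eq (i : Fin 2) (ci : k) (e n : ℕ) (g : MvPowerSeries (Fin 2) k) :
    C (ci ^ e) * TupleGame.slice i (subst (CobordantChart.chart (fun l : Fin 2 => if l = i then 1 else 0)
        (fun l : Fin 2 => if l = i then ci else 0)) ((X i : MvPowerSeries (Fin 2) k) ^ n * g)) =
      (X 0 : MvPowerSeries (Fin 2) k) ^ n * (C (ci ^ e * ci ^ n) * TupleGame.slice i (subst (CobordantChart.chart
        (fun l : Fin 2 => if l = i then 1 else 0) (fun l : Fin 2 => if l = i then ci else 0)) g)) := by
  rw [slice_subst_axisChart_X_pow_mul, mul_pow, ← map_pow, map_mul]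
  ring

/-- The curve-step successor coefficient keeps a vanishing constant term. -/
theorem constantCoeff_curveSucc (i : Fin 2) (ci : k) (e n : ℕ) {g : MvPowerSeries (Fin 2) k}
    (hg : constantCoeff g = 0) :
    constantCoeff (C (ci ^ e * ci ^ n) * TupleGame.slice i (subst (CobordantChart.chart
        (fun l : Fin 2 => if l = i then 1 else 0) (fun l : Fin 2 => if l = i then ci else 0)) g)) = 0 := by
  rw [map_mul, constantCoeff_slice_subst_axisChart, hg, mul_zero]

/-- The curve-step successor coefficient keeps an order bound (`c ≠ 0`). -/
theorem order_curveSucc_lt (i : Fin 2) {ci : k} (hci : ci ≠ 0) (e n : ℕ) {g : MvPowerSeries (Fin 2) k} {b : ℕ}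
    (hg : g.order < (b : ℕ∞)) :
    (C (ci ^ e * ci ^ n) * TupleGame.slice i (subst (CobordantChart.chart
        (fun l : Fin 2 => if l = i then 1 else 0) (fun l : Fin 2 => if l = i then ci else 0)) g)).order < (b : ℕ∞) :=
  order_C_mul_lt (mul_ne_zero (pow_ne_zero _ hci) (pow_ne_zero _ hci)) (order_slice_subst_axisChart_lt i hci g hg)

/-! ### The small-residual class is won -/

/-- S3ρT, SMALL-RESIDUAL HALF — THE SMALL-RESIDUAL MONIC SURFACE FORMS ARE WON (every characteristic `p`, every `d ≥ 1`):
given that the singular surface germs of order `< d` are won, every position `y^d + Σ_{j<d} A_j(x₁,x₂) y^j` (`ord A_j > d - j`)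
with `A_j = x_i^{(d-j)m} g_j` (`m ≥ 1`, `g_j(0) = 0` for all `j`) and `ord g_{j₁} < d - j₁` for some `j₁` is won — by `m` blow-ups
of the curve `V(x_i, y)`.  [OURS · L1 W4.3; Perlega §7.3 small residual type on the tuple; tuple version of S3πT's second branch.] -/
theorem termSR_won (p : ℕ) (hp : p.Prime) (k : Type) [Field k] [CharP k p] {d : ℕ} (hd : 0 < d)
    (hord : ∀ g : MvPowerSeries (Fin 3) k, CobordantGame.IsSingular k g → g.order < d → CobordantGame.Won k 3 g) :
    ∀ (n : ℕ), 0 < n → ∀ (i : Fin 2) (A : Fin d → MvPowerSeries (Fin 2) k),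
      (∀ j : Fin d, ((d - (j : ℕ) : ℕ) : ℕ∞) < (A j).order) →
      (∀ j : Fin d, ∃ g : MvPowerSeries (Fin 2) k, constantCoeff g = 0 ∧ A j = X i ^ ((d - (j : ℕ)) * n) * g) →
      (∃ (j₁ : Fin d) (g : MvPowerSeries (Fin 2) k), A j₁ = X i ^ ((d - (j₁ : ℕ)) * n) * g ∧
        g.order < ((d - (j₁ : ℕ) : ℕ) : ℕ∞)) →
      CobordantGame.Won k (2 + 1) ((X (Fin.last 2) : MvPowerSeries (Fin (2 + 1)) k) ^ d +
        ∑ j : Fin d, rename (Fin.succAboveEmb (Fin.last 2)) (A j) * X (Fin.last 2) ^ (j : ℕ)) := by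
  classical
  intro n
  induction n with
  | zero => intro h; exact absurd h (lt_irrefl 0)
  | succ n ih =>
  intro _ i A hA hdiv hres
  choose g hg0 hAg using hdiv
  obtain ⟨j₁, g₁, hA₁, hg₁⟩ := hres
  -- `g j₁ = g₁` (cancel the power of `x_i`)
  have hg₁' : (g j₁).order < ((d - (j₁ : ℕ) : ℕ) : ℕ∞) := by
    have heq : g j₁ = g₁ := eq_of_X_pow_mul_eq i _ (by rw [← hAg j₁, hA₁])
    rw [heq]; exact hg₁
  -- the permissible curve `V(x_i, y)`: `A_j = x_i^{d-j} · (x_i^{(d-j)n} g_j)`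
  set A'' : Fin d → MvPowerSeries (Fin 2) k := fun j => X i ^ ((d - (j : ℕ)) * n) * g j with hA''
  have hdivA : ∀ j : Fin d, A j = X i ^ (d - (j : ℕ)) * A'' j := fun j => by
    rw [hAg j, hA'', Nat.mul_succ, pow_add]; ring
  have hA''0 : ∀ j : Fin d, constantCoeff (A'' j) = 0 := fun j => by
    rw [hA'', map_mul, hg0 j, mul_zero]
  refine won_monic_of_curveBlowup p hp k 2 d hd i A A'' hdivA hA''0 fun ci hci hSs => ?_
  -- the successor tuple `s^{(d-j)n} · g'_j`
  set g' : Fin d → MvPowerSeries (Fin 2) k := fun j => C (ci ^ (d - (j : ℕ)) * ci ^ ((d - (j : ℕ)) * n)) *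
    TupleGame.slice i (subst (CobordantChart.chart (fun l : Fin 2 => if l = i then 1 else 0)
      (fun l : Fin 2 => if l = i then ci else 0)) (g j)) with hg'
  have hsucc : ∀ j : Fin d, C (ci ^ (d - (j : ℕ))) * TupleGame.slice i (subst (CobordantChart.chart
      (fun l : Fin 2 => if l = i then 1 else 0) (fun l : Fin 2 => if l = i then ci else 0)) (A'' j)) =
      (X 0 : MvPowerSeries (Fin 2) k) ^ ((d - (j : ℕ)) * n) * g' j := fun j => by
    rw [hA'', hg']; exact curveSucc_eq i ci _ _ (g j)
  have hg'0 : ∀ j : Fin d, constantCoeff (g' j) = 0 := fun j => constantCoeff_curveSucc i ci _ _ (hg0 j)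
  have hg'₁ : (g' j₁).order < ((d - (j₁ : ℕ) : ℕ) : ℕ∞) := order_curveSucc_lt i hci _ _ hg₁'
  simp only [hsucc] at hSs ⊢
  rcases Nat.eq_zero_or_pos n with hn | hn
  · -- last curve blow-up: the order drops below `d`
    subst hn
    refine hord _ hSs ?_
    obtain ⟨β, hβ, hc⟩ := exists_coeff_ne_zero_of_order_lt hg'₁
    refine lt_of_le_of_lt (order_monicForm_le_of_coeff _ j₁ β ?_) ?_
    · simpa using hc
    · have := j₁.2; exact_mod_cast (by omega : β.degree + (j₁ : ℕ) < d)
  · -- otherwise: the same class with `n` in the slot `0`, a position again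
    refine ih hn 0 (fun j => (X 0 : MvPowerSeries (Fin 2) k) ^ ((d - (j : ℕ)) * n) * g' j) (fun j => ?_)
      (fun j => ⟨g' j, hg'0 j, rfl⟩) ⟨j₁, g' j₁, rfl, hg'₁⟩
    refine lt_of_lt_of_le ?_ (succ_le_order_X_pow_mul 0 _ (hg'0 j))
    have := j.2
    exact_mod_cast (by nlinarith : d - (j : ℕ) < (d - (j : ℕ)) * n + 1)

end WildMonic

end Summit.ResolutionOfSingularities.ResolutionOfSingularities.Theorems
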